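import Literature.GroupTheory.CombinatorialGroupTheory.CoveringSystem
import HarnessLib

/-!
# The Schreier ribbon graph of a subgroup, I: the boundary face over a cusp orbit

Topic `Literature/GroupTheory/CombinatorialGroupTheory`; continues `CoveringSystem.lean`.
For an action `act : F(X) → Sym(A)` (the cosets of a subgroup `K` of finite index in the free
group `F(X)`) the covering graph with vertices `A` and edge letters `(X × A) × Bool` is a ribbon
graph once the base bouquet carries a rotation, i.e. a one-vertex system of boundary faces `S`
over `X × Bool` (ZVC §3.1, §4.14).  Its boundary faces are NOT the lifts of the base faces (a cusp
word `L` need not act trivially) but the closed lifts of the POWERS `L^m`: over the base face with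
boundary word `L` and a vertex `b` whose orbit under `c = mk L` has size `m`, the face of the
covering is

  `liftAt act (List.replicate m L).flatten b = liftAt act ((List.replicate m L).flatten) b`,

the lift of `L^m = L ⋯ L` ending at `b` (a closed path since `c^m · b = b`).  This file is the
letter-by-letter bookkeeping of these faces: the `i`-th letter lies over `L[i mod |L|]` and ends at
`(c^k · L_{<j})⁻¹ · b` (`i = k|L| + j`); the face is duplicate-free when `m` is the exact period;
its word is the path word of `c^m` (so its Schreier rewriting is `t(b)⁻¹ c^m t(b)`,
`gammaHom_pathWord`); and along the face the successor of a letter ends where the letter starts and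
lies over the successor in `L` — the two hypotheses of the covering lemma
`sameCycle_sysPerm_iff_of_covering` (`FaceSystemCoverings.lean`).  The system of all these faces
and its contraction to a one-vertex system is `SchreierRibbonGraph.lean`
(Hoare–Karrass–Solitar 1971, Thm. 1; ZVC Thm. 4.14.1).

## References

* H. Zieschang, E. Vogt, H.-D. Coldewey, *Surfaces and Planar Discontinuous Groups*, LNM 835,
  Springer 1980, 2.2.3, 3.1.2, 4.14.1. [ZieschangVogtColdewey1980]
* A. H. M. Hoare, A. Karrass, D. Solitar, *Subgroups of finite index of Fuchsian groups*,
  Math. Z. 120 (1971) 289–298, Thm. 1. [HoareKarrassSolitar1971]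
-/

namespace Literature.GroupTheory.CombinatorialGroupTheory

open List Equiv Equiv.Perm

/-! ### Powers of a word -/

section PowWord

variable {α : Type*}

/-- The `m`-th power `L^m = L ⋯ L` of a word is `(List.replicate m L).flatten`; the zeroth power
is empty. [cite: ZieschangVogtColdewey1980, 4.14.1] -/
theorem powWord_zero (L : List α) : (List.replicate 0 L).flatten = [] := rfl

/-- `L^(m+1) = L ++ L^m`. [cite: ZieschangVogtColdewey1980, 4.14.1] -/
theorem powWord_succ (L : List α) (m : ℕ) :
    (List.replicate (m + 1) L).flatten = L ++ (List.replicate m L).flatten := by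
  rw [replicate_succ, flatten_cons]

/-- The length of a power. [cite: ZieschangVogtColdewey1980, 4.14.1] -/
@[simp] theorem length_powWord (L : List α) (m : ℕ) : ((List.replicate m L).flatten).length = m * L.length := by
  induction m with
  | zero => simp
  | succ m ih => rw [powWord_succ, length_append, ih]; ring

/-- The free-group element of a power of a word is the power of the element.
[cite: ZieschangVogtColdewey1980, 4.14.1] -/
theorem mk_powWord {β : Type*} (L : List (β × Bool)) (m : ℕ) :
    FreeGroup.mk ((List.replicate m L).flatten) = FreeGroup.mk L ^ m := by
  induction m with
  | zero => rfl
  | succ m ih => rw [powWord_succ, ← FreeGroup.mul_mk, ih, pow_succ']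

/-- The letters of a power, by position. [cite: ZieschangVogtColdewey1980, 4.14.1] -/
theorem getElem_powWord (L : List α) (m : ℕ) (i : ℕ) (hi : i < ((List.replicate m L).flatten).length) :
    ((List.replicate m L).flatten)[i] = L[i % L.length]'(Nat.mod_lt _ (by
      rw [length_powWord] at hi
      rcases Nat.eq_zero_or_pos L.length with h | h
      · rw [h, mul_zero] at hi; exact absurd hi (Nat.not_lt_zero _)
      · exact h)) := by
  induction m generalizing i with
  | zero => exact absurd hi (by simp)
  | succ m ih =>
    simp only [powWord_succ]
    by_cases h : i < L.length
    · simp only [getElem_append_left h, Nat.mod_eq_of_lt h]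
    · rw [not_lt] at h
      have hi' : i - L.length < ((List.replicate m L).flatten).length := by
        rw [powWord_succ, length_append] at hi; omega
      rw [getElem_append_right h, ih (i - L.length) hi']
      congr 1
      exact (Nat.mod_eq_sub_mod h).symm


/-- Initial segments of a power: `take (k |L| + j) L^m = L^k ++ take j L` for `k < m`.
[cite: ZieschangVogtColdewey1980, 4.14.1] -/
theorem take_powWord (L : List α) {m k : ℕ} (hk : k < m) (j : ℕ) (hj : j ≤ L.length) :
    ((List.replicate m L).flatten).take (k * L.length + j) = (List.replicate k L).flatten ++ L.take j := by
  induction k generalizing m with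
  | zero =>
    obtain ⟨m', rfl⟩ : ∃ m', m = m' + 1 := ⟨m - 1, by omega⟩
    rw [zero_mul, zero_add, powWord_succ, powWord_zero, nil_append, take_append_of_le_length hj]
  | succ k ih =>
    obtain ⟨m', rfl⟩ : ∃ m', m = m' + 1 := ⟨m - 1, by omega⟩
    have e : (k + 1) * L.length + j = L.length + (k * L.length + j) := by ring
    rw [powWord_succ, e, take_length_add_append, ih (by omega), powWord_succ, append_assoc]

/-- The whole power is an initial segment of itself. [cite: ZieschangVogtColdewey1980, 4.14.1] -/
theorem take_powWord_length (L : List α) (m : ℕ) :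
    ((List.replicate m L).flatten).take (m * L.length) = (List.replicate m L).flatten := by
  rw [← length_powWord, take_length]

end PowWord

namespace CoveringPresentation

universe u v

variable {X : Type u} {A : Type v} (act : FreeGroup X →* Equiv.Perm A)

/-! ### Letters of a lift, by position -/

/-- **The letters of a lifted path, by position**: the `i`-th letter of the lift of `R` ending at
`c` is the edge letter over `R[i]` ending at `(R_{<i})⁻¹ · c`. [cite: ZieschangVogtColdewey1980, 2.2.3] -/
theorem getElem_liftAt : ∀ (R : List (X × Bool)) (c : A) (i : ℕ) (hi : i < (liftAt act R c).length),
    (liftAt act R c)[i] =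
      edgeLetter act (R[i]'(by rwa [length_liftAt] at hi)) (act (FreeGroup.mk (R.take i))⁻¹ c)
  | [], c, i, hi => absurd hi (by simp [liftAt])
  | β :: R, c, 0, hi => by
    simp only [liftAt, getElem_cons_zero, take_zero]
    rw [show (FreeGroup.mk ([] : List (X × Bool))) = 1 from rfl, inv_one, map_one, Perm.one_apply]
  | β :: R, c, i + 1, hi => by
    simp only [liftAt, getElem_cons_succ, take_succ_cons]
    have hi' : i < (liftAt act R (act (FreeGroup.mk [β])⁻¹ c)).length := by
      simp only [liftAt, length_cons] at hi; omega
    rw [getElem_liftAt R _ i hi']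
    congr 1
    rw [show β :: R.take i = [β] ++ R.take i from rfl, ← FreeGroup.mul_mk, mul_inv_rev, map_mul,
      Perm.mul_apply]

/-- The `i`-th letter of a lift lies over the `i`-th base letter. [cite: ZieschangVogtColdewey1980, 2.2.3] -/
theorem proj_getElem_liftAt (R : List (X × Bool)) (c : A) (i : ℕ) (hi : i < (liftAt act R c).length) :
    proj ((liftAt act R c)[i]) = R[i]'(by rwa [length_liftAt] at hi) := by
  rw [getElem_liftAt, proj_edgeLetter]

/-- The `i`-th letter of a lift ends at `(R_{<i})⁻¹ · c`. [cite: ZieschangVogtColdewey1980, 2.2.3] -/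
theorem fin_getElem_liftAt (R : List (X × Bool)) (c : A) (i : ℕ) (hi : i < (liftAt act R c).length) :
    fin act ((liftAt act R c)[i]) = act (FreeGroup.mk (R.take i))⁻¹ c := by
  rw [getElem_liftAt, fin_edgeLetter]

/-- The `i`-th letter of a lift starts at `(R_{<i+1})⁻¹ · c`. [cite: ZieschangVogtColdewey1980, 2.2.3] -/
theorem ini_getElem_liftAt (R : List (X × Bool)) (c : A) (i : ℕ) (hi : i < (liftAt act R c).length) :
    ini act ((liftAt act R c)[i]) = act (FreeGroup.mk (R.take (i + 1)))⁻¹ c := by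
  have hi' : i < R.length := by rwa [length_liftAt] at hi
  rw [getElem_liftAt, ini_edgeLetter, take_succ_eq_append_getElem hi', ← FreeGroup.mul_mk, mul_inv_rev,
    map_mul, Perm.mul_apply]

/-! ### The face over a cusp orbit -/

/-! The boundary face of the covering over the base face with word `L` and the orbit of `b`
(of size `m` under `mk L`) is `liftAt act (List.replicate m L).flatten b`, the lift of `L^m`
ending at `b` — a closed path. -/

/-- The length of an orbit face. [cite: ZieschangVogtColdewey1980, 4.14.1] -/
@[simp] theorem length_orbitFace (L : List (X × Bool)) (b : A) (m : ℕ) :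
    (liftAt act (List.replicate m L).flatten b).length = m * L.length := by
  rw [length_liftAt, length_powWord]

/-- **The word of an orbit face is the path word of `c^m`** (hence its Schreier rewriting is
`t(b)⁻¹ · c^m · t(b)`, `gammaHom_pathWord`). [cite: ZieschangVogtColdewey1980, 2.2.3] -/
theorem mk_orbitFace (L : List (X × Bool)) (b : A) (m : ℕ) :
    FreeGroup.mk (liftAt act (List.replicate m L).flatten b) = pathWord act (FreeGroup.mk L ^ m) b := by
  rw [mk_liftAt, mk_powWord]

/-- The letters of an orbit face lie over `L`, cyclically: the `i`-th over `L[i mod |L|]`.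
[cite: ZieschangVogtColdewey1980, 4.14.1] -/
theorem proj_getElem_orbitFace (L : List (X × Bool)) (b : A) (m : ℕ) (i : ℕ)
    (hi : i < (liftAt act (List.replicate m L).flatten b).length) (hL : 0 < L.length) :
    proj ((liftAt act (List.replicate m L).flatten b)[i]) = L[i % L.length]'(Nat.mod_lt _ hL) := by
  rw [proj_getElem_liftAt, getElem_powWord]

/-- **The vertices along an orbit face**: the letter in position `k |L| + j` (`k < m`, `j < |L|`)
ends at `(c^k · L_{<j})⁻¹ · b`, `c = mk L`. [cite: ZieschangVogtColdewey1980, 4.14.1] -/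
theorem fin_getElem_orbitFace (L : List (X × Bool)) (b : A) {m k j : ℕ} (hk : k < m) (hj : j < L.length)
    (hi : k * L.length + j < (liftAt act (List.replicate m L).flatten b).length) :
    fin act ((liftAt act (List.replicate m L).flatten b)[k * L.length + j]) =
      act (FreeGroup.mk L ^ k * FreeGroup.mk (L.take j))⁻¹ b := by
  rw [fin_getElem_liftAt, take_powWord L hk j hj.le, ← FreeGroup.mul_mk, mk_powWord]

/-- Every position of an orbit face is `k |L| + j` with `k < m`, `j < |L|`.
[cite: ZieschangVogtColdewey1980, 4.14.1] -/
theorem exists_eq_mul_add_of_lt {n m i : ℕ} (hi : i < m * n) :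
    ∃ k j, k < m ∧ j < n ∧ i = k * n + j := by
  have hn : 0 < n := Nat.pos_of_ne_zero fun h => by rw [h, mul_zero] at hi; exact Nat.not_lt_zero _ hi
  refine ⟨i / n, i % n, ?_, Nat.mod_lt _ hn, ?_⟩
  · exact Nat.div_lt_of_lt_mul (by rwa [mul_comm] at hi)
  · rw [mul_comm]; exact (Nat.div_add_mod i n).symm

/-- **An orbit face is duplicate-free** when `L` is duplicate-free and `m` is the exact period of
`b` under `c = mk L` (no `0 < k < m` has `c^k` fixing... more precisely the points `c^{-k} b`,
`k < m`, are pairwise distinct). [cite: ZieschangVogtColdewey1980, 4.14.1] -/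
theorem nodup_orbitFace {L : List (X × Bool)} (hL : L.Nodup) (b : A) {m : ℕ}
    (hper : ∀ k₁ k₂, k₁ < m → k₂ < m → act (FreeGroup.mk L ^ k₁)⁻¹ b = act (FreeGroup.mk L ^ k₂)⁻¹ b → k₁ = k₂) :
    (liftAt act (List.replicate m L).flatten b).Nodup := by
  rw [nodup_iff_injective_getElem]
  rintro ⟨i₁, hi₁⟩ ⟨i₂, hi₂⟩ h
  simp only at h
  have hlen := length_orbitFace act L b m
  obtain ⟨k₁, j₁, hk₁, hj₁, rfl⟩ := exists_eq_mul_add_of_lt (hlen ▸ hi₁)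
  obtain ⟨k₂, j₂, hk₂, hj₂, rfl⟩ := exists_eq_mul_add_of_lt (hlen ▸ hi₂)
  have hL0 : 0 < L.length := by omega
  -- same base letter: same `j`
  have hp := congrArg proj h
  rw [proj_getElem_orbitFace act L b m _ hi₁ hL0, proj_getElem_orbitFace act L b m _ hi₂ hL0] at hp
  have hj : j₁ = j₂ := by
    have e1 : (k₁ * L.length + j₁) % L.length = j₁ := by
      rw [Nat.mul_add_mod_of_lt hj₁]
    have e2 : (k₂ * L.length + j₂) % L.length = j₂ := by
      rw [Nat.mul_add_mod_of_lt hj₂]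
    have := (nodup_iff_injective_getElem.1 hL) (a₁ := ⟨_, Nat.mod_lt _ hL0⟩) (a₂ := ⟨_, Nat.mod_lt _ hL0⟩) hp
    simp only [Fin.mk.injEq, e1, e2] at this
    exact this
  subst hj
  -- same end vertex: same `k`
  have hf := congrArg (fin act) h
  rw [fin_getElem_orbitFace act L b hk₁ hj₁ hi₁, fin_getElem_orbitFace act L b hk₂ hj₁ hi₂,
    mul_inv_rev, mul_inv_rev, map_mul, map_mul, Perm.mul_apply, Perm.mul_apply] at hf
  have hf' := (act (FreeGroup.mk (L.take j₁))⁻¹).injective hf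
  have := hper k₁ k₂ hk₁ hk₂ hf'
  subst this
  rfl

variable [DecidableEq X] [DecidableEq A]

/-- **The successor along an orbit face lies over the successor in `L`.**
[cite: ZieschangVogtColdewey1980, 3.1.2] -/
theorem proj_formPerm_orbitFace {L : List (X × Bool)} (hL : L.Nodup) (b : A) {m : ℕ}
    (hd : (liftAt act (List.replicate m L).flatten b).Nodup) {u : (X × A) × Bool} (hu : u ∈ liftAt act (List.replicate m L).flatten b) :
    proj ((liftAt act (List.replicate m L).flatten b).formPerm u) = L.formPerm (proj u) := by
  obtain ⟨i, hi, rfl⟩ := getElem_of_mem hu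
  have hlen := length_orbitFace act L b m
  have hL0 : 0 < L.length := by
    rcases Nat.eq_zero_or_pos L.length with h | h
    · rw [h, mul_zero] at hlen; rw [hlen] at hi; exact absurd hi (Nat.not_lt_zero _)
    · exact h
  rw [formPerm_apply_getElem _ hd i hi, proj_getElem_orbitFace act L b m _ _ hL0,
    proj_getElem_orbitFace act L b m _ _ hL0, formPerm_apply_getElem _ hL]
  congr 1
  rw [hlen, Nat.mod_mod_of_dvd _ (Dvd.intro_left m rfl), Nat.add_mod i 1, Nat.add_mod (i % L.length) 1,
    Nat.mod_mod]

/-- **The successor along an orbit face ends where the letter starts** (the face is a closed path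
because `c^m` fixes `b`). [cite: ZieschangVogtColdewey1980, 3.1.2] -/
theorem fin_formPerm_orbitFace (L : List (X × Bool)) (b : A) {m : ℕ}
    (hfix : act (FreeGroup.mk L ^ m) b = b) (hd : (liftAt act (List.replicate m L).flatten b).Nodup)
    {u : (X × A) × Bool} (hu : u ∈ liftAt act (List.replicate m L).flatten b) :
    fin act ((liftAt act (List.replicate m L).flatten b).formPerm u) = ini act u := by
  obtain ⟨i, hi, rfl⟩ := getElem_of_mem hu
  have hlen := length_orbitFace act L b m
  rw [formPerm_apply_getElem _ hd i hi]
  rw [fin_getElem_liftAt, ini_getElem_liftAt]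
  by_cases hlast : i + 1 < (liftAt act ((List.replicate m L).flatten) b).length
  · rw [Nat.mod_eq_of_lt hlast]
  · have he : i + 1 = (liftAt act ((List.replicate m L).flatten) b).length := by omega
    rw [← he, Nat.mod_self, take_zero, show (FreeGroup.mk ([] : List (X × Bool))) = 1 from rfl,
      inv_one, map_one, Perm.one_apply, he, length_liftAt, take_length, mk_powWord, map_inv]
    symm
    rw [Perm.inv_eq_iff_eq]
    exact hfix.symm

omit [DecidableEq X] [DecidableEq A] in
/-- **Membership in an orbit face**: a letter lies on `orbitFace L b m` iff it is the edge letter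
over some `L[j]` ending at `(c^k · L_{<j})⁻¹ · b` with `k < m`. [cite: ZieschangVogtColdewey1980, 4.14.1] -/
theorem mem_orbitFace_iff (L : List (X × Bool)) (b : A) (m : ℕ) (l : (X × A) × Bool) :
    l ∈ liftAt act (List.replicate m L).flatten b ↔ ∃ (k j : ℕ) (hj : j < L.length), k < m ∧
      l = edgeLetter act L[j] (act (FreeGroup.mk L ^ k * FreeGroup.mk (L.take j))⁻¹ b) := by
  constructor
  · intro hl
    obtain ⟨i, hi, rfl⟩ := getElem_of_mem hl
    have hlen := length_orbitFace act L b m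
    obtain ⟨k, j, hk, hj, rfl⟩ := exists_eq_mul_add_of_lt (hlen ▸ hi)
    refine ⟨k, j, hj, hk, ?_⟩
    rw [getElem_liftAt, take_powWord L hk j hj.le, ← FreeGroup.mul_mk, mk_powWord]
    congr 1
    rw [getElem_powWord]
    congr 1
    exact Nat.mul_add_mod_of_lt hj
  · rintro ⟨k, j, hj, hk, rfl⟩
    have hi : k * L.length + j < (liftAt act (List.replicate m L).flatten b).length := by
      rw [length_orbitFace]
      calc k * L.length + j < k * L.length + L.length := by omega
        _ = (k + 1) * L.length := by ring
        _ ≤ m * L.length := Nat.mul_le_mul_right _ hk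
    have e : (liftAt act (List.replicate m L).flatten b)[k * L.length + j] =
        edgeLetter act L[j] (act (FreeGroup.mk L ^ k * FreeGroup.mk (L.take j))⁻¹ b) := by
      rw [getElem_liftAt, take_powWord L hk j hj.le, ← FreeGroup.mul_mk, mk_powWord]
      congr 1
      rw [getElem_powWord]
      congr 1
      exact Nat.mul_add_mod_of_lt hj
    rw [← e]
    exact getElem_mem hi

end CoveringPresentation

end Literature.GroupTheory.CombinatorialGroupTheory
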